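import Mathlib
import HarnessLib
import Std.Data.TreeMap
import Literature.NumberTheory.LFunctions.ZetaHintedEvaluation

/-!
# A kernel-cheap certified upper bound for `‖ζ(s)‖` on a box at height `t ≈ 3·10³`

Trunk T-ANT (NumberTheory/LFunctions) with T-VALNUM; companion of `ZetaHintedEvaluation.lean`.
For sup bounds of `‖ζ‖` on discs of radius `≈ 0.3` (Cauchy estimates in Newton–Kantorovich certificates) the
complex box of the main Euler–Maclaurin sum is useless — the phases `t log n` spread over several radians when `t`
ranges over an interval of length `0.6` — but the crude bound `|Σ_{n<N} n^{-s}| ≤ Σ_{n<N} n^{-σ₀}`,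
`σ₀ = lo(re sB)/S`, is kernel-cheap and adequate (`≈ 50` at `σ₀ ≈ 0.5`, `N = 800`).

* `mkTablesJ` / `mkTablesJ_valid`: `Tables` (in the sense of `ZetaCertifiedEvaluation.lean`) whose logarithm
  table — never read by the hinted evaluators — is the constant valid enclosure `[0, 8]` (`N < 2047`);
* `rEntry`, `rStep`, `rBuild`, `RInv`: the hinted walk building `n ↦ [n^{-σ₀}]` in a `Std.TreeMap ℕ MI` and the
  running sum of upper endpoints (same hint list and validity predicate `HintsValid` as the complex evaluator);
* **`zetaAbsBoundH` / `norm_zeta_mul_le_zetaAbsBoundH`**: `T.Valid → HintsValid T.S 0 hints →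
  T.N ≤ hints.length → log N ∈ LN → s ∈ sB → s ≠ 1 → zetaAbsBoundH T sB hints LN = some U → ‖ζ(s)‖·S ≤ U`
  (main sum by the real table, the `N`-terms, the correction terms `termsBoxPN` and the remainder `remRadius` by
  box arithmetic and `MC.absHi`).

First consumer: the unconditional certificate for Haglund's Conjecture 1 at `N = 27` (`Haglund2011/`),
refutations bundle `papers/_cross/refutations`, item (x).  AI-produced formalisation (H21 seat pub-refute-2,
2026-08-19).

## References
* H. M. Edwards, *Riemann's Zeta Function* (1974), §6.4. [Edwards1974]
* R. E. Moore, *Interval Analysis* (1966). [folklore]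
-/

set_option autoImplicit false

open Finset Complex
open Literature.Analysis.ValidatedNumerics.NumericsMP Literature.NumberTheory.LFunctions

namespace Literature.NumberTheory.LFunctions.ZetaNumerics

/-! ## Tables with a constant logarithm enclosure -/

/-- The constant enclosure `[0, 8]` of `log n`, valid for `1 ≤ n ≤ 2047`. [folklore] -/
def junkLog (S : ℕ) : MI := ⟨0, 8 * S⟩

/-- `log n ∈ [0, 8]` for `1 ≤ n < 2048`. [folklore] -/
lemma mem_junkLog (S : ℕ) {n : ℕ} (h1 : 1 ≤ n) (h2 : n < 2048) : MI.mem S (Real.log n) (junkLog S) := by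
  have hlog0 : 0 ≤ Real.log n := Real.log_nonneg (by exact_mod_cast h1)
  have hlog8 : Real.log n ≤ 8 := by
    have hn : (n : ℝ) < 2048 := by exact_mod_cast h2
    have h2048 : Real.log 2048 = 11 * Real.log 2 := by
      rw [show (2048 : ℝ) = 2 ^ 11 by norm_num, Real.log_pow]; norm_num
    have hle : Real.log n ≤ Real.log 2048 := Real.log_le_log (by exact_mod_cast h1) hn.le
    have := Real.log_two_lt_d9
    linarith
  refine ⟨?_, ?_⟩
  · simp only [junkLog, Int.cast_zero]; positivity
  · simp only [junkLog]; push_cast; nlinarith [Nat.cast_nonneg (α := ℝ) S]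

/-- `Tables` for the Euler–Maclaurin evaluator whose logarithm table is the constant `[0, 8]` (never read by
the hinted evaluator; present so that `Tables.Valid` and the soundness lemmas of `ZetaCertifiedEvaluation.lean`
apply verbatim): `π` by Machin at scale `S·2^guard`, the ratios of the correction terms. [folklore] -/
def mkTablesJ (S N nu guard Kpi Kexp kexp KI kI : ℕ) : Option Tables :=
  let S' := S * 2 ^ guard
  if 0 < S ∧ 2 ≤ N ∧ N < 2047 ∧ nu ≠ 0 then
    match MI.pi S' Kpi, emRatios nu with
    | some P, some R => some ⟨S, N, nu, MI.rescale S' S P, Array.replicate (N + 1) (junkLog S), R, Kexp, kexp, KI, kI⟩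
    | _, _ => none
  else none

/-- Tables built by `mkTablesJ` are valid. [folklore] -/
theorem mkTablesJ_valid {S N nu guard Kpi Kexp kexp KI kI : ℕ} {T : Tables}
    (h : mkTablesJ S N nu guard Kpi Kexp kexp KI kI = some T) : T.Valid := by
  unfold mkTablesJ at h
  simp only at h
  split_ifs at h with hc
  split at h
  · rename_i P R hP hR
    simp only [Option.some.injEq] at h
    subst h
    obtain ⟨hS, hN, hN2, hnu⟩ := hc
    have hS' : 0 < S * 2 ^ guard := Nat.mul_pos hS (pow_pos (by norm_num) _)
    refine ⟨hS, hN, hnu, MI.mem_rescale hS' S (MI.mem_pi _ hP), by simp, fun n h1 h2 ↦ ?_, hR⟩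
    dsimp only at h2 ⊢
    have hget : (Array.replicate (N + 1) (junkLog S)).getD n default = junkLog S := by
      rw [Array.getD_eq_getD_getElem?, Array.getElem?_replicate, if_pos (by omega), Option.getD_some]
    simp only [hget]
    exact mem_junkLog S h1 (by omega)
  · simp at h

/-! ## A kernel-cheap upper bound for `‖ζ(s)‖` on a box -/

/-- The state of the real walk: the map `n ↦ [n^{-σ₀}]` and the running sum of upper endpoints. [folklore] -/
structure RAcc where
  /-- `map[n] ∋ n^{-σ₀}` -/
  map : Std.TreeMap ℕ MI compare
  /-- `Σ_{1 ≤ n < m} hi(map[n])` -/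
  sumHi : ℤ

/-- The interval of `n^{-σ₀}`, `σ₀ ∈ X`, from the hint. [folklore] -/
def rEntry (T : Tables) (X : MI) (A : RAcc) (n : ℕ) (h : ℕ × MI) : Option MI :=
  if n = 1 then some (MI.ofInt T.S 1)
  else if useFactor n h.1 then some (MI.mul T.S (A.map.getD h.1 default) (A.map.getD (n / h.1) default))
  else MI.exp T.S T.Kexp T.kexp ((X.mul T.S h.2).neg)

/-- One step of the real walk. [folklore] -/
def rStep (T : Tables) (X : MI) (A : RAcc) (n : ℕ) (h : ℕ × MI) : Option RAcc :=
  if n = 0 then some A else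
    match rEntry T X A n h with
    | none => none
    | some b => some ⟨A.map.insert n b, A.sumHi + b.hi⟩

/-- The real walk. [folklore] -/
def rBuild (T : Tables) (X : MI) : ℕ → List (ℕ × MI) → RAcc → Option RAcc
  | _, [], A => some A
  | n, h :: hs, A =>
    match rStep T X A n h with
    | none => none
    | some A' => rBuild T X (n + 1) hs A'

/-- Invariant of the real walk before index `m`. [folklore] -/
structure RInv (S : ℕ) (σ₀ : ℝ) (m : ℕ) (A : RAcc) : Prop where
  mem_map : ∀ j : ℕ, 1 ≤ j → j < m → MI.mem S ((j : ℝ) ^ (-σ₀)) (A.map.getD j default)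
  sum_le : (∑ j ∈ Finset.Ico 1 m, (j : ℝ) ^ (-σ₀)) * S ≤ A.sumHi

/-- Soundness of `rEntry`. [folklore] -/
lemma mem_rEntry {T : Tables} (hT : T.Valid) {σ₀ : ℝ} {X : MI} (hX : MI.mem T.S σ₀ X) {A : RAcc} {m : ℕ}
    (hI : RInv T.S σ₀ m A) (hm : 1 ≤ m) {h : ℕ × MI}
    (hh : m ≤ 1 ∨ useFactor m h.1 = true ∨ MI.mem T.S (Real.log m) h.2) {b : MI}
    (hb : rEntry T X A m h = some b) : MI.mem T.S ((m : ℝ) ^ (-σ₀)) b := by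
  unfold rEntry at hb
  split_ifs at hb with h1 h2
  · simp only [Option.some.injEq] at hb
    subst hb; rw [h1]; simpa using MI.mem_ofInt T.S 1
  · simp only [Option.some.injEq] at hb
    subst hb
    obtain ⟨hf1, hfm, hfd⟩ := useFactor_spec h2
    have hq1 : 1 ≤ m / h.1 := by rw [Nat.one_le_div_iff (by omega)]; exact hfm.le
    have hqlt : m / h.1 < m := Nat.div_lt_self (by omega) hf1
    have hx := hI.mem_map h.1 (by omega) hfm
    have hy := hI.mem_map (m / h.1) hq1 hqlt
    have key : ((m : ℕ) : ℝ) ^ (-σ₀) = (h.1 : ℝ) ^ (-σ₀) * ((m / h.1 : ℕ) : ℝ) ^ (-σ₀) := by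
      rw [← Real.mul_rpow (by positivity) (by positivity), ← Nat.cast_mul, Nat.mul_div_cancel' hfd]
    rw [key]
    exact MI.mem_mul hT.S_pos hx hy
  · rcases hh with hh | hh | hh
    · omega
    · exact absurd hh h2
    · have hm0 : (0 : ℝ) < m := by exact_mod_cast (show 0 < m by omega)
      have h3 : MI.mem T.S (-(σ₀ * Real.log m)) ((X.mul T.S h.2).neg) := MI.mem_neg (MI.mem_mul hT.S_pos hX hh)
      have := MI.mem_exp hT.S_pos hb h3
      rw [Real.rpow_def_of_pos hm0]
      convert this using 2
      ring

/-- Soundness of `rStep`. [folklore] -/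
lemma rInv_rStep {T : Tables} (hT : T.Valid) {σ₀ : ℝ} {X : MI} (hX : MI.mem T.S σ₀ X) {A A' : RAcc} {m : ℕ}
    (hI : RInv T.S σ₀ m A) {h : ℕ × MI} (hh : m ≤ 1 ∨ useFactor m h.1 = true ∨ MI.mem T.S (Real.log m) h.2)
    (hst : rStep T X A m h = some A') : RInv T.S σ₀ (m + 1) A' := by
  unfold rStep at hst
  split_ifs at hst with h0
  · simp only [Option.some.injEq] at hst
    subst hst; subst h0
    exact ⟨fun j h1 h2 ↦ by omega, by simpa using hI.sum_le⟩
  · split at hst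
    · simp at hst
    · rename_i b hb
      simp only [Option.some.injEq] at hst
      subst hst
      have hm1 : 1 ≤ m := by omega
      have hbm := mem_rEntry hT hX hI hm1 hh hb
      refine ⟨fun j h1 h2 ↦ ?_, ?_⟩
      · show MI.mem T.S ((j : ℝ) ^ (-σ₀)) ((A.map.insert m b).getD j default)
        rw [Std.TreeMap.getD_insert]
        split_ifs with hc
        · rw [Nat.compare_eq_eq] at hc
          subst hc; exact hbm
        · rw [Nat.compare_eq_eq] at hc
          exact hI.mem_map j h1 (by omega)
      · show (∑ j ∈ Finset.Ico 1 (m + 1), (j : ℝ) ^ (-σ₀)) * T.S ≤ ((A.sumHi + b.hi : ℤ) : ℝ)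
        rw [Finset.sum_Ico_succ_top hm1, add_mul]
        push_cast
        exact add_le_add hI.sum_le hbm.2

/-- Soundness of `rBuild`. [folklore] -/
theorem rInv_rBuild {T : Tables} (hT : T.Valid) {σ₀ : ℝ} {X : MI} (hX : MI.mem T.S σ₀ X) :
    ∀ (hs' : List (ℕ × MI)) (m : ℕ) {A A' : RAcc}, RInv T.S σ₀ m A → HintsValid T.S m hs' →
      rBuild T X m hs' A = some A' → RInv T.S σ₀ (m + hs'.length) A'
  | [], m, A, A', hI, _, h => by
    simp only [rBuild, Option.some.injEq] at h
    subst h; simpa using hI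
  | hh :: hs', m, A, A', hI, hv, h => by
    simp only [rBuild] at h
    split at h
    · simp at h
    · rename_i A1 hA1
      have hI1 := rInv_rStep hT hX hI hv.1 hA1
      have := rInv_rBuild hT hX hs' (m + 1) hI1 hv.2 h
      simp only [List.length_cons]
      rw [show m + (hs'.length + 1) = m + 1 + hs'.length by ring]
      exact this

/-- **Kernel-cheap upper bound for `‖ζ(s)‖·S` on the box `sB`**: the main sum by `Σ_{n<N} n^{-σ₀}`,
`σ₀ = lo(re sB)/S`, the `N`-terms, correction terms and remainder by box arithmetic. [folklore] -/
def zetaAbsBoundH (T : Tables) (sB : MC) (hints : List (ℕ × MI)) (LN : MI) : Option ℤ :=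
  if 0 < sB.re.lo then
    match rBuild T (MI.lower sB.re) 0 (hints.take T.N) ⟨∅, 0⟩, cpowL T sB LN with
    | some R, some PN =>
      match MC.divBox T.S (PN.mulInt T.N) (sB.sub (MC.ofInt T.S 1)) with
      | none => none
      | some q => some (R.sumHi + (PN.divNat 2).absHi + q.absHi + (termsBoxPN T sB PN).absHi + remRadius T sB)
    | _, _ => none
  else none

/-- `HintsValid` is inherited by prefixes. [folklore] -/
lemma hintsValid_take {S : ℕ} : ∀ (hs : List (ℕ × MI)) (m k : ℕ), HintsValid S m hs → HintsValid S m (hs.take k)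
  | [], m, k, _ => by simp [HintsValid]
  | h :: hs, m, 0, _ => by simp [HintsValid]
  | h :: hs, m, k + 1, hv => by
    simp only [List.take_succ_cons]
    exact ⟨hv.1, hintsValid_take hs (m + 1) k hv.2⟩

/-- The entry of a valid hint list at position `k` (index `m + k`). [folklore] -/
lemma hintsValid_getElem {S : ℕ} : ∀ (hs : List (ℕ × MI)) (m k : ℕ) {h : ℕ × MI}, HintsValid S m hs →
    hs[k]? = some h → (m + k ≤ 1 ∨ useFactor (m + k) h.1 = true ∨ MI.mem S (Real.log (m + k : ℕ)) h.2)
  | [], m, k, h, _, hk => by simp at hk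
  | h' :: hs, m, 0, h, hv, hk => by
    simp only [List.getElem?_cons_zero, Option.some.injEq] at hk
    subst hk; simpa using hv.1
  | h' :: hs, m, k + 1, h, hv, hk => by
    simp only [List.getElem?_cons_succ] at hk
    have := hintsValid_getElem hs (m + 1) k hv.2 hk
    rw [show m + 1 + k = m + (k + 1) by ring] at this
    exact this

/-- **Soundness of the bound**: `‖ζ(s)‖ · S ≤ zetaAbsBoundH T sB hints LN` for `s ∈ sB`, `s ≠ 1`, valid hints
(at least `N` of them) and `LN ∋ log N`. [folklore] -/
theorem norm_zeta_mul_le_zetaAbsBoundH {T : Tables} (hT : T.Valid) {hints : List (ℕ × MI)}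
    (hv : HintsValid T.S 0 hints) (hlen : T.N ≤ hints.length) {LN : MI} (hLN : MI.mem T.S (Real.log T.N) LN)
    {s : ℂ} {sB : MC} (hs : MC.mem T.S s sB) (hs1 : s ≠ 1) {U : ℤ} (h : zetaAbsBoundH T sB hints LN = some U) :
    ‖riemannZeta s‖ * T.S ≤ U := by
  unfold zetaAbsBoundH at h
  split_ifs at h with hlo
  split at h
  · rename_i R PN hR hPN
    split at h
    · simp at h
    · rename_i q hq
      simp only [Option.some.injEq] at h
      subst h
      have hSr : (0 : ℝ) < T.S := by exact_mod_cast hT.S_pos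
      have hσ : 0 < s.re := MI.pos_of_lo_pos hs.1 hlo
      have hN1 : 1 ≤ T.N := le_trans (by norm_num) hT.two_le_N
      -- `σ₀ ≤ σ`
      set σ₀ : ℝ := (sB.re.lo : ℝ) / T.S with hσ₀
      have hX : MI.mem T.S σ₀ (MI.lower sB.re) := MI.mem_lower hT.S_pos sB.re
      have hσ₀σ : σ₀ ≤ s.re := MI.lo_div_le hT.S_pos hs.1
      -- the real table
      have hRI := rInv_rBuild hT hX (hints.take T.N) 0 (A := ⟨∅, 0⟩)
        ⟨fun j h1 h2 ↦ by omega, by simp⟩ (hintsValid_take hints 0 T.N hv) hR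
      rw [List.length_take, min_eq_left hlen, zero_add] at hRI
      -- `PN ∋ N^{-s}`
      have hPNm : MC.mem T.S ((T.N : ℂ) ^ (-s)) PN := mem_cpowL hT hs hN1 hLN hPN
      -- bound each piece
      have h1 : ‖∑ j ∈ Finset.Ico 1 T.N, (j : ℂ) ^ (-s)‖ * T.S ≤ R.sumHi := by
        refine le_trans (mul_le_mul_of_nonneg_right (norm_sum_le _ _) hSr.le) ?_
        refine le_trans (mul_le_mul_of_nonneg_right (Finset.sum_le_sum fun j hj ↦ ?_) hSr.le) hRI.sum_le
        rw [Finset.mem_Ico] at hj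
        rw [Complex.norm_natCast_cpow_of_pos (by omega), neg_re]
        exact Real.rpow_le_rpow_of_exponent_le (by exact_mod_cast hj.1) (by linarith)
      have h2 : ‖(T.N : ℂ) ^ (-s) / 2‖ * T.S ≤ (PN.divNat 2).absHi := by
        have := MC.mem_divNat hPNm (n := 2) (by norm_num)
        exact MC.norm_le_absHi (by simpa using this)
      have h3 : ‖(T.N : ℂ) ^ (1 - s) / (s - 1)‖ * T.S ≤ q.absHi := by
        have hq' := MC.mem_divBox hT.S_pos hq (MC.mem_mulInt hPNm (T.N : ℤ))
          (MC.mem_sub hs (MC.mem_ofInt T.S 1))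
        refine MC.norm_le_absHi ?_
        convert hq' using 1
        have hN0 : (T.N : ℂ) ≠ 0 := by exact_mod_cast (show T.N ≠ 0 by omega)
        rw [sub_eq_add_neg, cpow_add _ _ hN0, cpow_one]
        push_cast
        ring
      have h4 : ‖∑ j ∈ Finset.Icc 1 T.nu, emTerm T.N s j‖ * T.S ≤ (termsBoxPN T sB PN).absHi :=
        MC.norm_le_absHi (mem_termsBoxPN hT hs hPNm)
      have h5 := norm_emRem_mul_le_remRadius hT hs hσ
      rw [riemannZeta_eq_eulerMaclaurin_of_re_pos hN1 hσ hs1 T.nu]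
      unfold emMainZero
      have htri : ‖∑ n ∈ Finset.Ico 1 T.N, (n : ℂ) ^ (-s) + (T.N : ℂ) ^ (1 - s) / (s - 1) + (T.N : ℂ) ^ (-s) / 2 +
          ∑ k ∈ Finset.Icc 1 T.nu, emTerm T.N s k + emRemHigher T.N T.nu s‖ ≤
          ‖∑ n ∈ Finset.Ico 1 T.N, (n : ℂ) ^ (-s)‖ + ‖(T.N : ℂ) ^ (1 - s) / (s - 1)‖ + ‖(T.N : ℂ) ^ (-s) / 2‖ +
          ‖∑ k ∈ Finset.Icc 1 T.nu, emTerm T.N s k‖ + ‖emRemHigher T.N T.nu s‖ := by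
        refine (norm_add_le _ _).trans (add_le_add ((norm_add_le _ _).trans (add_le_add
          ((norm_add_le _ _).trans (add_le_add ((norm_add_le _ _).trans le_rfl) le_rfl)) le_rfl)) le_rfl)
      have := mul_le_mul_of_nonneg_right htri hSr.le
      refine this.trans ?_
      push_cast
      nlinarith [h1, h2, h3, h4, h5]
  · simp at h

end Literature.NumberTheory.LFunctions.ZetaNumerics
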